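import Summits.BirchSwinnertonDyer.BirchSwinnertonDyer.Theorems.ByReductionTypeAtTwoTowerLambdaPinch
import Summits.BirchSwinnertonDyer.Rank1Residual.Additive.CongruentPartnerBudgetSchemaHolds
import Literature.NumberTheory.EllipticCurves.Greenberg1999.NoProperFiniteIndexSubmodule
import HarnessLib

/-!
# The TOWER door with BOTH `λ`-side inputs as finite-layer certificates: `2^n ≤ #X/(2,T^j)X` + Greenberg
# Prop. 4.14 at `2` (no finite submodule, PRINT, any `p`) ⇒ `n ≤ λ(X)` (route ByReductionTypeAtTwo,
# crux child `OrdKatoHalfAtTwo`, item stmt-BirchSwinnertonDyer-19150; seat bsd-2adic-ord-2)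

HONEST FRAMING (cell `bsd-2adic`, run/shared/lean/pub/bsd-2adic/, HUMAN RULINGS D-0036/D-0074): THEOREMS
ONLY; nothing asserted; no definition; no new named fact; closes nothing. Companion of
`Theorems/ByReductionTypeAtTwoTowerLambdaPinch.lean`: there the door to the `2`-adic main conjecture /
`BSD(E,2)` on the OPEN good-ordinary block (any residual image) took the algebraic input `n ≤ λ(X)`
as a hypothesis. Here that input is DISCHARGED from the same kind of finite-layer datum the
tower-gap certificate already uses — a lower bound `2^n ≤ #X/(2,T^j)X` for ONE `j` (`hrank`) —
together with the PUBLISHED Greenberg 1999 Prop. 4.14 (typed for every prime, `X` has no nonzero finite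
`Λ`-submodule when `p ∤ #E(ℚ)_tors`; automatic on the 440 open classes with `E[2]` irreducible):

* §1 (pure `Λ`-algebra, any `p`): `M` finitely generated torsion, `μ(M) = 0`, no nonzero finite
  submodule ⇒ `#(M/(p,T^j)M) ≤ #(M/pM) = p^{λ(M)}` (landed: `card_quotient_eq_pow_lambdaInvariant_holds`,
  `TowerGap.natCard_quotient_towerIdeal_le_natCard_quotient_modP`), hence
  `p^n ≤ #(M/(p,T^j)M) ⇒ n ≤ λ(M)`.
* §2 (`p = 2`, a curve with odd torsion order): `TowerGapAtTwo W` + the RANK certificate + Prop. 4.14@2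
  ⇒ `n ≤ λ(X)` for every cyclotomic datum; §3 the doors of the companion file with this input
  discharged: PRINT {Kato 17.4 (1)(2)@2, Greenberg 4.14@2; at rank 0 also Greenberg 4.1@2, modularity,
  GZK} + certificates {`hper₀`, `μ_an = 0`, `λ_an = n`, `TowerGapAtTwo W`, `TowerRank n`} ⇒
  `MazurMainConjecture W 2`, both halves, `BSDp W 2`.

So on a curve with `2 ∤ #E(ℚ)_tors` the WHOLE algebraic input of the `2`-adic IMC is carried by the
numbers `a_j = dim_{𝔽₂} X/(2,T^j)X` for finitely many `j`: `∃ m k, a_{m+k} < k + a_m` (gap) and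
`a_j ≥ λ_an` (rank). WHAT IS STILL MISSING for a class-level certificate run (typed input for a
successor, not asserted here): the exact `[2]`-level control identifying `a_{2^m}` with the
`𝔽₂`-dimension of the generalised `2`-Selmer group of `E` over the layer `ℚ_m` with the local
conditions induced from `ℚ_∞` (Greenberg LNM 1716 §3 read at `p = 2`; inflation–restriction is exact
because `E(ℚ_∞)[2] = 0`), and a `2`-descent engine over `ℚ(√2)` / `ℚ(ζ₁₆)⁺`.

References: R. Greenberg, LNM 1716 (1999), Prop. 4.14, §3, Thm. 4.1; K. Kato, Astérisque 295 (2004),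
Thm. 17.4; L. Washington, *Introduction to Cyclotomic Fields*, §13.2; Y. Hachimori, K. Matsuno, Proc.
AMS 128 (2000).
-/

set_option autoImplicit false

noncomputable section

open scoped Classical MatrixGroups ModularForm

open CongruenceSubgroup WeierstrassCurve Literature.NumberTheory.EllipticCurves
  Literature.NumberTheory.EllipticCurves.ModularForms Literature.NumberTheory.EllipticCurves.Rank1Residual
  Literature.NumberTheory.EllipticCurves.Rank1Residual.Typed
  Literature.NumberTheory.EllipticCurves.Greenberg1999
  Summit.BirchSwinnertonDyer.Rank1Residual.X1.MuLambda
  Summit.BirchSwinnertonDyer.Rank1Residual.X1.MuPart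
  Summit.BirchSwinnertonDyer.Rank1Residual.X1.ParitySqueeze
  Summit.BirchSwinnertonDyer.BirchSwinnertonDyer.Theorems.Rank1ResidualX1Defs
  Summit.BirchSwinnertonDyer.Rank1Residual.X5 Summit.BirchSwinnertonDyer.Rank1Residual.X5.O1
  Summit.BirchSwinnertonDyer.Rank1Residual.X5.TowerGap

namespace Summit.BirchSwinnertonDyer.BirchSwinnertonDyer.Theorems.KatoHalfPinch

/-! ## §1 `p^n ≤ #(M/(p,T^j)M) ⇒ n ≤ λ(M)` under `μ = 0` and no finite submodule (any `p`) -/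

section Algebra

variable (p : ℕ) [Fact p.Prime] {M : Type*} [AddCommGroup M] [Module (IwasawaAlgebra p) M]

/-- **A finite-layer lower bound for `λ`.** For a finitely generated torsion `Λ = ℤ_p⟦T⟧`-module `M`
with `μ(M) = 0` and no nonzero finite `Λ`-submodule, every layer quotient satisfies
`#(M/(p,T^j)M) ≤ p^{λ(M)}`; hence `p^n ≤ #(M/(p,T^j)M)` gives `n ≤ λ(M)`. (`M` is `ℤ_p`-free of rank
`λ(M)`, so `#(M/pM) = p^{λ(M)}`, and `M/(p,T^j)M` is a quotient of `M/pM`.)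
[cite: Washington1997, §13.2 (after Thm. 13.12)] [cite: GreenbergLNM1716, §1 (p. 60)] -/
theorem le_lambdaInvariant_of_pow_le_natCard_quotient_towerIdeal [Module.Finite (IwasawaAlgebra p) M]
    (hT : Module.IsTorsion (IwasawaAlgebra p) M) (hμ : muInvariant p M = 0)
    (hnf : ∀ N : Submodule (IwasawaAlgebra p) M, Finite N → N = ⊥) {n j : ℕ}
    (h : p ^ n ≤ Nat.card (M ⧸ (towerIdeal p j • ⊤ : Submodule (IwasawaAlgebra p) M))) :
    n ≤ lambdaInvariant p M := by
  have hcard : Nat.card (M ⧸ (IwasawaAlgebra.augIdealP p • (⊤ : Submodule (IwasawaAlgebra p) M))) =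
      p ^ lambdaInvariant p M :=
    Summit.BirchSwinnertonDyer.Rank1Residual.Additive.card_quotient_eq_pow_lambdaInvariant_holds p M hT
      hμ hnf
  have hfin : Finite (M ⧸ modPSubmodule p M) := TowerGap.finite_modP_of_isTorsion_of_mu_eq_zero p hT hμ
  have hle := TowerGap.natCard_quotient_towerIdeal_le_natCard_quotient_modP p hfin j
  have hmodP : Nat.card (M ⧸ modPSubmodule p M) = p ^ lambdaInvariant p M := hcard
  have hp : 1 < p := (Fact.out : p.Prime).one_lt
  exact (Nat.pow_le_pow_iff_right hp).mp (h.trans (hle.trans hmodP.le))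

end Algebra

/-! ## §2 `p = 2`: the RANK certificate + Greenberg Prop. 4.14@2 ⇒ `n ≤ λ(X(E/ℚ_∞))` -/

section Curve

variable (W : WeierstrassCurve ℚ) [W.IsElliptic] [W.IsGloballyMinimal]

/-- **`n ≤ λ(X(E/ℚ_∞))` from finite-layer data.** `W` with ODD torsion order (`2 ∤ #E(ℚ)_tors`, e.g.
`E[2]` irreducible); PUBLISHED Greenberg 1999 Prop. 4.14 (typed for every prime: `X` torsion ⇒ no
nonzero finite `Λ`-submodule); certificates: `TowerGapAtTwo W` (⟺ `X` torsion ∧ `μ(X) = 0`) and the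
RANK certificate `2^n ≤ #X/(2,T^j)X` for some `j`, for every cyclotomic datum (`hrank`). Then
`n ≤ λ(X)` for every cyclotomic datum. [cite: GreenbergLNM1716, Prop. 4.14 (§4)]
[cite: Washington1997, §13.2] -/
theorem le_lambda_of_towerGap_of_towerRank (h414 : prop414_noFiniteSubmodule_of_not_dvd_torsionOrder)
    (htors : ¬ 2 ∣ W.torsionOrder) (hgap : TowerGapAtTwo W) {n : ℕ}
    (hrank : ∀ (κ : ZpExtension ℚ 2) (γ : Field.absoluteGaloisGroup ℚ), κ.IsCyclotomic →
      κ.IsTopGenerator γ → IsCyclotomicVariable 2 γ → ∀ D : W.SelmerDualData κ γ,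
      ∃ j : ℕ, 2 ^ n ≤ Nat.card (D.X ⧸ (towerIdeal 2 j • ⊤ : Submodule (IwasawaAlgebra 2) D.X)))
    (κ : ZpExtension ℚ 2) (γ : Field.absoluteGaloisGroup ℚ) (hκ : κ.IsCyclotomic)
    (hγ : κ.IsTopGenerator γ) (hγ' : IsCyclotomicVariable 2 γ) (D : W.SelmerDualData κ γ) :
    n ≤ D.lambda := by
  haveI : Module.Finite (IwasawaAlgebra 2) D.X := D.module_finite_holds hγ
  obtain ⟨hX, hμ⟩ := isTorsion_and_mu_eq_zero_of_towerGapAtTwo W hgap hκ hγ hγ' D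
  obtain ⟨j, hj⟩ := hrank κ γ hκ hγ hγ' D
  exact le_lambdaInvariant_of_pow_le_natCard_quotient_towerIdeal 2 hX hμ
    (fun N hN => h414 W 2 htors κ γ hκ hγ D hX N hN) hj

/-! ## §3 The doors with every algebraic input a finite-layer certificate -/

/-- **Door (TOWER, certificate form): `MazurMainConjecture W 2`** at a good ordinary `2` with odd
torsion order, from PRINT {Kato 17.4 (1)(2)@2, Greenberg Prop. 4.14@2} + certificates {`hper₀`,
`TowerGapAtTwo W`, `TowerRank n` (`hrank`), `μ_an = 0`, `λ_an = n`} — any analytic rank, any residual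
image; no `BSD(E,2)`, no Eisenstein input. [cite: Kato2004Asterisque, Thm. 17.4 (1)(2) (p. 273)]
[cite: GreenbergLNM1716, Prop. 4.14 (§4)] [cite: GreenbergVatsal2000, p. 4 (after Thm. (1.2))] -/
theorem mazurMainConjecture_two_of_towerGap_of_towerRank
    (h17 : ∀ [NeZero (W.conductorNorm ℤ)] (f : CuspForm (Gamma0 (W.conductorNorm ℤ)) 2),
      kato_divisibility_allPrimes W 2 (f := f))
    (h414 : prop414_noFiniteSubmodule_of_not_dvd_torsionOrder)
    (hper₀ : ∀ [NeZero (W.conductorNorm ℤ)] (f : CuspForm (Gamma0 (W.conductorNorm ℤ)) 2),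
      IsNewformOf W f → ∀ ϖ : ℚ, (ϖ : ℝ) * W.realPeriodRat = plusPeriod f → 0 ≤ padicValRat 2 ϖ)
    (hgo : GoodOrd W 2) (htors : ¬ 2 ∣ W.torsionOrder) (hgap : TowerGapAtTwo W) {n : ℕ}
    (hrank : ∀ (κ : ZpExtension ℚ 2) (γ : Field.absoluteGaloisGroup ℚ), κ.IsCyclotomic →
      κ.IsTopGenerator γ → IsCyclotomicVariable 2 γ → ∀ D : W.SelmerDualData κ γ,
      ∃ j : ℕ, 2 ^ n ≤ Nat.card (D.X ⧸ (towerIdeal 2 j • ⊤ : Submodule (IwasawaAlgebra 2) D.X)))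
    (hlan : AnalyticLambdaEq W 2 n) (hμan : AnalyticMuLE W 2 0) : MazurMainConjecture W 2 :=
  mazurMainConjecture_two_of_towerGap_of_lambda_le W h17 hper₀ hgo hgap hlan hμan
    (le_lambda_of_towerGap_of_towerRank W h414 htors hgap hrank)

/-- **The Kato–Néron half (the item `OrdKatoHalfAtTwo` AT `W`), certificate form.**
[cite: Kato2004Asterisque, Thm. 17.4 (1)(2) (p. 273)] [cite: GreenbergLNM1716, Prop. 4.14 (§4)] -/
theorem katoHalfAt_two_of_towerGap_of_towerRank
    (h17 : ∀ [NeZero (W.conductorNorm ℤ)] (f : CuspForm (Gamma0 (W.conductorNorm ℤ)) 2),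
      kato_divisibility_allPrimes W 2 (f := f))
    (h414 : prop414_noFiniteSubmodule_of_not_dvd_torsionOrder)
    (hper₀ : ∀ [NeZero (W.conductorNorm ℤ)] (f : CuspForm (Gamma0 (W.conductorNorm ℤ)) 2),
      IsNewformOf W f → ∀ ϖ : ℚ, (ϖ : ℝ) * W.realPeriodRat = plusPeriod f → 0 ≤ padicValRat 2 ϖ)
    (hgo : GoodOrd W 2) (htors : ¬ 2 ∣ W.torsionOrder) (hgap : TowerGapAtTwo W) {n : ℕ}
    (hrank : ∀ (κ : ZpExtension ℚ 2) (γ : Field.absoluteGaloisGroup ℚ), κ.IsCyclotomic →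
      κ.IsTopGenerator γ → IsCyclotomicVariable 2 γ → ∀ D : W.SelmerDualData κ γ,
      ∃ j : ℕ, 2 ^ n ≤ Nat.card (D.X ⧸ (towerIdeal 2 j • ⊤ : Submodule (IwasawaAlgebra 2) D.X)))
    (hlan : AnalyticLambdaEq W 2 n) (hμan : AnalyticMuLE W 2 0) :
    MainConjectureLowerDivisibilityAtTwoOrd W :=
  katoHalfAt_two_of_towerGap_of_lambda_le W h17 hper₀ hgo hgap hlan hμan
    (le_lambda_of_towerGap_of_towerRank W h414 htors hgap hrank)

/-- **Door (TOWER, certificate form) for `BSD(E,2)` at analytic rank `0`** on a good-ordinary-at-`2`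
curve with odd torsion order: PRINT {modularity, GZK, Kato 17.4 (1)(2)@2, Greenberg Thm. 4.1@2
(`hEC`, δ = 0), Greenberg Prop. 4.14@2} + certificates {`hper₀`, `TowerGapAtTwo W`, `TowerRank n`,
`μ_an = 0`, `λ_an = n`} ⇒ `BSDp W 2`. [cite: GreenbergLNM1716, Thm. 4.1 (p. 102), Prop. 4.14 (§4)]
[cite: Kato2004Asterisque, Thm. 17.4 (1)(2) (p. 273)] [cite: Miller2011LMS, Def. 1.1] -/
theorem bsdp_two_of_towerGap_of_towerRank (hmod : nonempty_modularParametrizationData)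
    (hGZK : rank_eq_analyticRank_of_analyticRank_le_one)
    (h17 : ∀ [NeZero (W.conductorNorm ℤ)] (f : CuspForm (Gamma0 (W.conductorNorm ℤ)) 2),
      kato_divisibility_allPrimes W 2 (f := f))
    (hEC : TwoAdicEulerCharRankZero W 0) (h414 : prop414_noFiniteSubmodule_of_not_dvd_torsionOrder)
    (hper₀ : ∀ [NeZero (W.conductorNorm ℤ)] (f : CuspForm (Gamma0 (W.conductorNorm ℤ)) 2),
      IsNewformOf W f → ∀ ϖ : ℚ, (ϖ : ℝ) * W.realPeriodRat = plusPeriod f → 0 ≤ padicValRat 2 ϖ)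
    (hgo : GoodOrd W 2) (hr : W.analyticRank = 0) (htors : ¬ 2 ∣ W.torsionOrder)
    (hgap : TowerGapAtTwo W) {n : ℕ}
    (hrank : ∀ (κ : ZpExtension ℚ 2) (γ : Field.absoluteGaloisGroup ℚ), κ.IsCyclotomic →
      κ.IsTopGenerator γ → IsCyclotomicVariable 2 γ → ∀ D : W.SelmerDualData κ γ,
      ∃ j : ℕ, 2 ^ n ≤ Nat.card (D.X ⧸ (towerIdeal 2 j • ⊤ : Submodule (IwasawaAlgebra 2) D.X)))
    (hlan : AnalyticLambdaEq W 2 n) (hμan : AnalyticMuLE W 2 0) : BSDp W 2 :=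
  bsdp_two_of_towerGap_of_lambda_le W hmod hGZK h17 hEC hper₀ hgo hr hgap hlan hμan
    (le_lambda_of_towerGap_of_towerRank W h414 htors hgap hrank)

end Curve

end Summit.BirchSwinnertonDyer.BirchSwinnertonDyer.Theorems.KatoHalfPinch

end
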